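import Summits.QuantumFields.YangMills.Theorems.BalabanUVNodesK1R9VersionSlotOfAEAtRecord
import Summits.QuantumFields.YangMills.Theorems.BalabanUVNodesK1R8RowsDefs

/-!
# BalabanUVNodes — THE (δ)-CONE IN THE KERNEL: a CANDIDATE deciding-theorem shape for the repair road (δ) NULL-SET SURGERY (director-ym №210, plan g84 WORD-3∕3b):
# `K0⁷ ∧ «K1 with the (B) conjunct displayed POINTWISE AT LEVEL 0 and dV_k-A.E. ABOVE» ∧ «K3 with the same (B)ᴬᴱ hypothesis and the BODY of the hybrid apex as conclusion»
# ⟹ the rung `BalabanLadder.UV`, through the datum surgery `T4DatumAssembly.TowerReviseAE` and K2⁸'s supplier by name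

Cell `pub-ymgap` (HUMAN RULING D-0062 Track A ∕ D-0149 width), WIDTH SEAT `pub-ymgap-dag-n13-w1` (gen 5, CLAIM-3), key K1⁸ `StabilityBRunRowsAtRecordR13SepCoPH` = stmt-QuantumFields-26907
(`--kind proof --supports … --as helper`; count-neutral).  NOT a route edit, NOT a registered skeleton, NOT the successor plan's shape sheet: a kernel-checked COMPOSITION of displayed hypothesis
texts, offered as input to plan g85's `D85-REV28/` kit (plan g84 ■ CLOSE «SUCCESSOR'S FIRST THREE STEPS (2)»); the (δⱽ) VERSION-SLOT spelling (DEF-1's `Node00/Record13SepCoPHV`, INTENT-10) runs the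
same proof over `datumOfRecord₁₃SepCoPHⱽ θ h v`.
[III] = [Balaban1988Convergent], [B16] = [Balaban1989LargeFieldII], [I] = [Balaban1987RG1].

WHAT.  §1 TRANSFER of the K3 apex shape along «same averaging, same small-field part» (DEF-1 g8's ANSWER (i) in kernel form): `scheme_eq_of_av_eq` (`FiniteEpsData.scheme` reads `D.av` only),
`tuned_iff_of_toB12_eq` (`Tuned` reads the flows = `C.toB12` only), ★ `hybridNE7Under_of_body_of_av_toB12_eq` (the BODY of `T4ApexHybrid.HybridNE7Under` at `D` ⟹ `HybridNE7Under D′ Hβ` for every `D′` with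
`D′.av = D.av`, `D′.C.toB12 = D.C.toB12`, every `Hβ` — the prefix's two antecedents, (B) at `D′` and `Hβ`, are not used).  §2 ★★★ `uv_of_record13_of_k1AE_of_k3AEBody` — hypotheses: `h0` = K0⁷
`Record13SepCoPHInhabited` VERBATIM; `h1` = K1⁸'s text with the (B) conjunct DISPLAYED as «`B16.Thm1Printed (datum).C` ∧ ∃ γ > 0, ∃ em ep, (2.50) on the γ-windowed runs at EVERY field of level 0 and
for `dV_k`-ALMOST EVERY field of levels `1 ≤ k ≤ K`», the window `K1V6Defs.Window (datum)` and the rows `K1R8RowsDefs.RunRowsCont13 F θ` BYTE-KEPT; `h3` = K3⁷'s text with the SAME (B)ᴬᴱ display as hypothesis,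
`DagBinding.EndpointExistence (datum).C.toB12`, and as CONCLUSION the BODY of `T4ApexHybrid.HybridNE7Under (datum) (EndpointExistence …)` (`∃ γ₀ > 0, ∀ γ ≤ γ₀, ∃ g₁ > 0, ∀ g ≤ g₁, ∀ g₀, (datum).Tuned γ g g₀ →
StringwiseHybridNE7 ((datum).scheme g₀)` — the prefix's (B)-pointwise antecedent, which nobody can supply at the version of record, REMOVED); conclusion `Summit.QuantumFields.YangMills.Theses.BalabanLadder.UV`.
PROOF: rows ⟹ `EndpointExistence` (`K1R8RowsDefs.endpointExistence_of_runRowsCont13`, K2⁸'s supplier, BY NAME); the surgery `TowerReviseAE.exists_datum_endStatementBPrinted_endpointExistence_of_ae_at_record`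
presents `D′` with `IsDatumOfRecord₀`, (B) AS TYPED, `EndpointExistence`, the record's `av` and `toB12`; §1 transfers the apex body to `D′`.

§3 THE (δⱽ) VERSION-SLOT SPELLING (DEF-1's `Node00/Record13SepCoPHV`, p620607 ✓; the K1⁹ (B)-slot supplier junction itself is this seat's ROUTE-FREE sibling
`…Theorems.BalabanUVNodesK1R9VersionSlotOfAEAtRecord`, imported): `k1V_of_k1AE` (the №210-letter K1 display ⟹ the slot display, item-shaped); ★★★ `uv_of_record13_of_k1V_of_k3V` — THE
(δⱽ)-CONE: K0⁷ ∧ «K1 with `∃ v, (B) at datumⱽ`, window, rows» ∧ «K3 keyed at the slot» ⟹ `BalabanLadder.UV` (DEF-1's `exists_datumOfRecord₀_spine_of_revision₁₃` +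
`endpointExistence_datumOfRecord₁₃SepCoPHV_iff` + K2⁸'s supplier; no transfer lemma).

READING (count-neutral; for plan g85's shape sheet, CRIT-1∕CRIT-2, dag-lead's gate).  (i) Under road (δ) the K3 item must either be KEYED AT THE REVISED DATUM ((δⱽ): K3⁸ over the slot `v`) or
conclude the apex BODY from (B)ᴬᴱ (this file's `h3`): transporting the IMPLICATION `HybridNE7Under (datumOfRecord₁₃SepCoPH θ h) …` from the record datum would need its antecedent, (B) pointwise at the
version of record — the unclosable letter (this seat's p618356; DEF-1 g8 ANSWER (i) concurs).  (ii) K2⁸ 26908 is consumed by name and stays closed in either spelling (`toB12` is version-blind).  (iii) Nothing here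
chooses between the two (δ) spellings; both compile against this seat's surgery file.

HONEST FRAMING.  A composition of DISPLAYED HYPOTHESES (pure logic over the tree's carriers + the surgery lemma); nothing of Bałaban's asserted or refuted; NO item proved, refuted, re-keyed or
registered; K0⁷ ∕ K1⁸ ∕ K3⁷ OPEN; counts unmoved (typed 28∕28 · discharged 5∕27, A 5∕28); one finite `𝕋⁴_{L^K}` programme at fixed ε; route R4 closes the CONDITIONAL finite-𝕋⁴ rung `BalabanLadder.UV` only —
the Yang–Mills mass gap (Clay) is NOT proved by any of this; nothing continuum ∕ ℝ⁴ ∕ OS.  No `sorry`, `def`, `instance`, `notation`; standard axioms.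
-/

noncomputable section

open scoped BigOperators ENNReal NNReal Matrix.Norms.L2Operator

namespace Summit.QuantumFields.YangMills.BalabanUVNodes.DeltaConeOfAERecordSketch

open MeasureTheory
open Literature.MathematicalPhysics.QuantumFieldTheory.Balaban1983to89
open Literature.MathematicalPhysics.QuantumFieldTheory.Balaban1983to89.T4Continuum (T4Family FiniteEpsData)
open Literature.MathematicalPhysics.QuantumFieldTheory.Balaban1983to89.Node00
open Literature.MathematicalPhysics.QuantumFieldTheory.Balaban1983to89.T4DatumAssembly.TowerReviseAE
  (exists_datum_endStatementBPrinted_endpointExistence_of_ae_at_record)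
open Summit.QuantumFields.YangMills.BalabanUVNodes.K1R9VersionSlotOfAEAtRecord
  (exists_revision₁₃_endStatementBPrinted_of_ae exists_revision₁₃_endStatementBPrinted_of_aeDisplay)
open Summit.QuantumFields.YangMills.Theorems.BalabanUVNodesK1R8RowsDefs (RunRowsCont13 endpointExistence_of_runRowsCont13)
open Summit.QuantumFields.YangMills.Theorems.K1V6Defs (Inhabited13 Window)
open Summit.QuantumFields.YangMills.Theses.BalabanUVNodes (Record13SepCoPHInhabited)

/-! ## §1 TRANSFER OF THE K3 APEX SHAPE ALONG «same averaging, same small-field part» -/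

section Transfer

variable {F : T4Family}

/-- The scheme of finite-`ε` expectations reads a datum ONLY through its averaging maps: equal `av` ⇒ equal schemes. [cite: Balaban1989LargeFieldII, (0.1) p.356 «averaged loop variables» (bookkeeping)] -/
theorem scheme_eq_of_av_eq {D D' : FiniteEpsData F (SU 2)} (hav : D.av = D'.av) (g₀ : ℕ → ℝ) : D.scheme g₀ = D'.scheme g₀ := by
  unfold FiniteEpsData.scheme FiniteEpsData.avgObs
  rw [hav]

/-- Tuning reads a datum ONLY through its small-field part `C.toB12` (the flows): equal `toB12` ⇒ the same tuned bare couplings. [cite: Balaban1987RG1, Thm 2 p.259 (bookkeeping)] -/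
theorem tuned_iff_of_toB12_eq {D D' : FiniteEpsData F (SU 2)} (hC : D.C.toB12 = D'.C.toB12) (γ g : ℝ) (g₀ : ℕ → ℝ) :
    D.Tuned γ g g₀ ↔ D'.Tuned γ g g₀ := by
  have hflow : ∀ P : B12.RunParams, (D.C P).flow = (D'.C P).flow := fun P => by
    have := congrFun hC P
    exact congrArg B12.RunData.flow this
  unfold FiniteEpsData.Tuned
  simp only [hflow]

/-- **THE K3 APEX SHAPE TRANSFERS TO ANY DATUM WITH THE SAME AVERAGING AND THE SAME SMALL-FIELD PART, GIVEN ITS BODY**: if the body of `HybridNE7Under` (the prefix's conclusion —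
per-string hybrid-NE7 radii along the tuned Wilson schemes) holds at `D`, then `HybridNE7Under D′ Hβ` holds for every `D′` with `D′.av = D.av`, `D′.C.toB12 = D.C.toB12` and every
β-side hypothesis `Hβ` ((B) at `D′` and `Hβ` are simply not used). [cite: Balaban1987RG1, Thm 2 p.259; Balaban1989LargeFieldII, (0.1) p.356 (bookkeeping over `T4Continuum.UnderHypotheses`)] -/
theorem hybridNE7Under_of_body_of_av_toB12_eq {D D' : FiniteEpsData F (SU 2)} (hav : D'.av = D.av) (hC : D'.C.toB12 = D.C.toB12) (Hβ : Prop)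
    (hbody : ∃ γ₀ : ℝ, 0 < γ₀ ∧ ∀ γ : ℝ, 0 < γ → γ ≤ γ₀ → ∃ g₁ : ℝ, 0 < g₁ ∧ ∀ g : ℝ, 0 < g → g ≤ g₁ →
      ∀ g₀ : ℕ → ℝ, D.Tuned γ g g₀ → T4ApexHybrid.StringwiseHybridNE7 (D.scheme g₀)) :
    T4ApexHybrid.HybridNE7Under D' Hβ := by
  intro _ _
  obtain ⟨γ₀, hγ₀, H⟩ := hbody
  refine ⟨γ₀, hγ₀, fun γ hγ hγle => ?_⟩
  obtain ⟨g₁, hg₁, H1⟩ := H γ hγ hγle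
  refine ⟨g₁, hg₁, fun g hg hgle g₀ htuned => ?_⟩
  show T4ApexHybrid.StringwiseHybridNE7 (D'.scheme g₀)
  rw [scheme_eq_of_av_eq hav]
  exact H1 g hg hgle g₀ ((tuned_iff_of_toB12_eq hC γ g g₀).mp htuned)

end Transfer

/-! ## §2 THE (δ) CONE: K0⁷ + «K1 with (B) a.e. above level 0» + «K3 with (B) a.e. hypothesis and the apex BODY» ⟹ the rung `BalabanLadder.UV` -/

section Cone

/-- **★★★ THE (δ)-CONE IN THE KERNEL (a CANDIDATE deciding-theorem shape for the successor plan's rev 28, director-ym №210 road (δ); NOT a route edit, NOT registered).**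
Hypotheses, all in the record's vocabulary: `h0` = K0⁷ VERBATIM; `h1` = K1⁸ with its (B) conjunct DISPLAYED as «Theorem 1's clause ∧ (2.50) with SOME `em ep` on the `γ`-windowed runs,
POINTWISE at level 0 and `dV_k`-A.E. at levels `1 ≤ k ≤ K`» (window and run rows (i)(iv)(C) = `K1R8RowsDefs.Window ∕ RunRowsCont13` BYTE-KEPT); `h3` = K3⁷ with the SAME (B)ᴬᴱ display as
hypothesis and, as conclusion, the BODY of `T4ApexHybrid.HybridNE7Under` at the record (the prefix's two antecedents removed — (B) pointwise at the record is exactly what nobody can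
supply).  Conclusion: `BalabanLadder.UV`.  PROOF: rows ⟹ `EndpointExistence` (K2⁸'s supplier `endpointExistence_of_runRowsCont13` BY NAME); the datum surgery
`TowerReviseAE.exists_datum_endStatementBPrinted_endpointExistence_of_ae_at_record` presents `D′` with (B) AS TYPED, the record's `av` and `toB12`; §1 transfers the apex body.
[cite: Balaban1989LargeFieldII, Thm 1 + (0.1) pp.355–356; Balaban1988Convergent, Cor. 3 (2.50) p.264; Balaban1987RG1, Thm 2 p.259, Thm 3 p.264 (bookkeeping; a composition of displayed hypotheses)] -/
theorem uv_of_record13_of_k1AE_of_k3AEBody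
    (h0 : Record13SepCoPHInhabited)
    (h1 : ∀ F : T4Family, Inhabited13 F →
      ∃ (θ : Stage13HParams F 2) (h : θ.Provisos₁₃SepCoPH F 2), (θ.ZhUnity F 2 ∧ θ.SlotsNondegenerate₁₃ F 2) ∧ θ.Admissible F 2 ∧
        (B16.Thm1Printed (datumOfRecord₁₃SepCoPH F 2 θ h).C ∧
          ∃ γ : ℝ, 0 < γ ∧ ∃ em ep : ℝ → ℝ,
            (∀ p : B12.RunParams, ((datumOfRecord₁₃SepCoPH F 2 θ h).C p).flow.InInterval γ p.K →
              ∀ V : GaugeField (F.P p.K) 0 (SU 2),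
                B16.UVIneq ((datumOfRecord₁₃SepCoPH F 2 θ h).C p) 0 V (em (((datumOfRecord₁₃SepCoPH F 2 θ h).C p).flow.g 0))
                  (ep (((datumOfRecord₁₃SepCoPH F 2 θ h).C p).flow.g 0))) ∧
            (∀ p : B12.RunParams, ((datumOfRecord₁₃SepCoPH F 2 θ h).C p).flow.InInterval γ p.K → ∀ k : ℕ, k + 1 ≤ p.K →
              ∀ᵐ V ∂fieldMeasure (F.P p.K) (k + 1) (SU 2),
                B16.UVIneq ((datumOfRecord₁₃SepCoPH F 2 θ h).C p) (k + 1) V (em (((datumOfRecord₁₃SepCoPH F 2 θ h).C p).flow.g (k + 1)))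
                  (ep (((datumOfRecord₁₃SepCoPH F 2 θ h).C p).flow.g (k + 1))))) ∧
        Window (datumOfRecord₁₃SepCoPH F 2 θ h) ∧ RunRowsCont13 F θ)
    (h3 : ∀ (F : T4Family) (θ : Stage13HParams F 2) (h : θ.Provisos₁₃SepCoPH F 2), (θ.ZhUnity F 2 ∧ θ.SlotsNondegenerate₁₃ F 2) → θ.Admissible F 2 →
      (B16.Thm1Printed (datumOfRecord₁₃SepCoPH F 2 θ h).C ∧
          ∃ γ : ℝ, 0 < γ ∧ ∃ em ep : ℝ → ℝ,
            (∀ p : B12.RunParams, ((datumOfRecord₁₃SepCoPH F 2 θ h).C p).flow.InInterval γ p.K →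
              ∀ V : GaugeField (F.P p.K) 0 (SU 2),
                B16.UVIneq ((datumOfRecord₁₃SepCoPH F 2 θ h).C p) 0 V (em (((datumOfRecord₁₃SepCoPH F 2 θ h).C p).flow.g 0))
                  (ep (((datumOfRecord₁₃SepCoPH F 2 θ h).C p).flow.g 0))) ∧
            (∀ p : B12.RunParams, ((datumOfRecord₁₃SepCoPH F 2 θ h).C p).flow.InInterval γ p.K → ∀ k : ℕ, k + 1 ≤ p.K →
              ∀ᵐ V ∂fieldMeasure (F.P p.K) (k + 1) (SU 2),
                B16.UVIneq ((datumOfRecord₁₃SepCoPH F 2 θ h).C p) (k + 1) V (em (((datumOfRecord₁₃SepCoPH F 2 θ h).C p).flow.g (k + 1)))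
                  (ep (((datumOfRecord₁₃SepCoPH F 2 θ h).C p).flow.g (k + 1))))) →
      DagBinding.EndpointExistence (datumOfRecord₁₃SepCoPH F 2 θ h).C.toB12 →
      ∃ γ₀ : ℝ, 0 < γ₀ ∧ ∀ γ : ℝ, 0 < γ → γ ≤ γ₀ → ∃ g₁ : ℝ, 0 < g₁ ∧ ∀ g : ℝ, 0 < g → g ≤ g₁ →
        ∀ g₀ : ℕ → ℝ, (datumOfRecord₁₃SepCoPH F 2 θ h).Tuned γ g g₀ →
          T4ApexHybrid.StringwiseHybridNE7 ((datumOfRecord₁₃SepCoPH F 2 θ h).scheme g₀)) :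
    Summit.QuantumFields.YangMills.Theses.BalabanLadder.UV := by
  intro F
  obtain ⟨θ, h, hU, hθ, hAE, _hwin, hrows⟩ := h1 F (h0 F)
  have hend : DagBinding.EndpointExistence (datumOfRecord₁₃SepCoPH F 2 θ h).C.toB12 := endpointExistence_of_runRowsCont13 θ h hrows
  have hbody := h3 F θ h hU hθ hAE hend
  obtain ⟨h1T, γ, hγ, em, ep, hlev0, hae⟩ := hAE
  obtain ⟨D, hD0, hB, hendD, hC', _hβ, hav, -, -⟩ :=
    exists_datum_endStatementBPrinted_endpointExistence_of_ae_at_record θ h hγ em ep h1T hlev0 hae hend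
  have hav' : D.av = (datumOfRecord₁₃SepCoPH F 2 θ h).av := hav
  exact ⟨D, hD0, hB, hendD, hybridNE7Under_of_body_of_av_toB12_eq hav' hC' _ hbody⟩

end Cone

/-! ## §3 THE (δⱽ) VERSION-SLOT SPELLING (DEF-1's `Node00/Record13SepCoPHV`, p620607): THE K1⁹ (B)-SLOT SUPPLIER JUNCTION AND THE (δⱽ) CONE -/

section VersionSlot

variable {F : T4Family}

/-- **★★★ THE (δⱽ)-CONE IN THE KERNEL (a CANDIDATE deciding-theorem shape in the version-slot spelling; NOT a route edit, NOT registered).**  Hypotheses: `h0` = K0⁷ VERBATIM;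
`h1` = K1⁸'s text with the (B) conjunct displayed `∃ v : Node00.Revision₁₃ F 2 θ h, B16.EndStatementBPrinted (Node00.datumOfRecord₁₃SepCoPHV F 2 θ h v).C` (B16's letter verbatim at a revised
datum), window and run rows BYTE-KEPT at the record datum (`K1V6Defs.Window`, `K1R8RowsDefs.RunRowsCont13`); `h3` = K3⁷'s text RE-KEYED AT THE SLOT (∀ `v`, B16 ∕ DagBinding ∕ T4ApexHybrid
letters verbatim at `datumOfRecord₁₃SepCoPHV F 2 θ h v`).  Conclusion: `BalabanLadder.UV`.  PROOF: rows ⟹ `EndpointExistence` at the record (`endpointExistence_of_runRowsCont13`, K2⁸'s supplier) =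
at the revised datum (DEF-1's `endpointExistence_datumOfRecord₁₃SepCoPHV_iff`, `Iff.rfl`); `h3` at the slot; DEF-1's `exists_datumOfRecord₀_spine_of_revision₁₃` presents the tuple.  No transfer lemma.
[cite: Balaban1989LargeFieldII, Thm 1 + (0.1) pp.355–356; Balaban1987RG1, Thm 2 p.259, Thm 3 p.264; Balaban1988Convergent, Cor. 3 (2.50) p.264 (bookkeeping; a composition of displayed hypotheses)] -/
theorem uv_of_record13_of_k1V_of_k3V
    (h0 : Record13SepCoPHInhabited)
    (h1 : ∀ F : T4Family, Inhabited13 F →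
      ∃ (θ : Stage13HParams F 2) (h : θ.Provisos₁₃SepCoPH F 2), (θ.ZhUnity F 2 ∧ θ.SlotsNondegenerate₁₃ F 2) ∧ θ.Admissible F 2 ∧
        (∃ v : Revision₁₃ F 2 θ h, B16.EndStatementBPrinted (datumOfRecord₁₃SepCoPHV F 2 θ h v).C) ∧
        Window (datumOfRecord₁₃SepCoPH F 2 θ h) ∧ RunRowsCont13 F θ)
    (h3 : ∀ (F : T4Family) (θ : Stage13HParams F 2) (h : θ.Provisos₁₃SepCoPH F 2) (v : Revision₁₃ F 2 θ h),
      (θ.ZhUnity F 2 ∧ θ.SlotsNondegenerate₁₃ F 2) → θ.Admissible F 2 →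
      B16.EndStatementBPrinted (datumOfRecord₁₃SepCoPHV F 2 θ h v).C →
      DagBinding.EndpointExistence (datumOfRecord₁₃SepCoPHV F 2 θ h v).C.toB12 →
      T4ApexHybrid.HybridNE7Under (datumOfRecord₁₃SepCoPHV F 2 θ h v)
        (DagBinding.EndpointExistence (datumOfRecord₁₃SepCoPHV F 2 θ h v).C.toB12)) :
    Summit.QuantumFields.YangMills.Theses.BalabanLadder.UV := by
  intro F
  obtain ⟨θ, h, hU, hθ, ⟨v, hB⟩, _hwin, hrows⟩ := h1 F (h0 F)
  have hend : DagBinding.EndpointExistence (datumOfRecord₁₃SepCoPHV F 2 θ h v).C.toB12 :=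
    (endpointExistence_datumOfRecord₁₃SepCoPHV_iff F 2 θ h v).mpr (endpointExistence_of_runRowsCont13 θ h hrows)
  exact exists_datumOfRecord₀_spine_of_revision₁₃ F 2 θ h v hB hend (h3 F θ h v hU hθ hB hend)

/-- **The №210-letter K1 display ⟹ the (δⱽ) K1 display, item-shaped** (so a supplier road concluding the a.e. display serves K1⁹ in the slot spelling).
[cite: Balaban1989LargeFieldII, Thm 1 + (0.1) pp.355–356; Balaban1988Convergent, Cor. 3 (2.50) p.264 (bookkeeping)] -/
theorem k1V_of_k1AE
    (h1 : ∀ F : T4Family, Inhabited13 F →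
      ∃ (θ : Stage13HParams F 2) (h : θ.Provisos₁₃SepCoPH F 2), (θ.ZhUnity F 2 ∧ θ.SlotsNondegenerate₁₃ F 2) ∧ θ.Admissible F 2 ∧
        (B16.Thm1Printed (datumOfRecord₁₃SepCoPH F 2 θ h).C ∧
          ∃ γ : ℝ, 0 < γ ∧ ∃ em ep : ℝ → ℝ,
            (∀ p : B12.RunParams, ((datumOfRecord₁₃SepCoPH F 2 θ h).C p).flow.InInterval γ p.K →
              ∀ V : GaugeField (F.P p.K) 0 (SU 2),
                B16.UVIneq ((datumOfRecord₁₃SepCoPH F 2 θ h).C p) 0 V (em (((datumOfRecord₁₃SepCoPH F 2 θ h).C p).flow.g 0))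
                  (ep (((datumOfRecord₁₃SepCoPH F 2 θ h).C p).flow.g 0))) ∧
            (∀ p : B12.RunParams, ((datumOfRecord₁₃SepCoPH F 2 θ h).C p).flow.InInterval γ p.K → ∀ k : ℕ, k + 1 ≤ p.K →
              ∀ᵐ V ∂fieldMeasure (F.P p.K) (k + 1) (SU 2),
                B16.UVIneq ((datumOfRecord₁₃SepCoPH F 2 θ h).C p) (k + 1) V (em (((datumOfRecord₁₃SepCoPH F 2 θ h).C p).flow.g (k + 1)))
                  (ep (((datumOfRecord₁₃SepCoPH F 2 θ h).C p).flow.g (k + 1))))) ∧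
        Window (datumOfRecord₁₃SepCoPH F 2 θ h) ∧ RunRowsCont13 F θ) :
    ∀ F : T4Family, Inhabited13 F →
      ∃ (θ : Stage13HParams F 2) (h : θ.Provisos₁₃SepCoPH F 2), (θ.ZhUnity F 2 ∧ θ.SlotsNondegenerate₁₃ F 2) ∧ θ.Admissible F 2 ∧
        (∃ v : Revision₁₃ F 2 θ h, B16.EndStatementBPrinted (datumOfRecord₁₃SepCoPHV F 2 θ h v).C) ∧
        Window (datumOfRecord₁₃SepCoPH F 2 θ h) ∧ RunRowsCont13 F θ := by
  intro F hF
  obtain ⟨θ, h, hU, hθ, hAE, hwin, hrows⟩ := h1 F hF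
  exact ⟨θ, h, hU, hθ, exists_revision₁₃_endStatementBPrinted_of_aeDisplay θ h hAE, hwin, hrows⟩

end VersionSlot

end Summit.QuantumFields.YangMills.BalabanUVNodes.DeltaConeOfAERecordSketch

end
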